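import Summits.KontsevichZagierPeriods.Zeta5Search.WellPoisedInteriorOddNoGoInstances
import Summits.KontsevichZagierPeriods.Zeta5Search.WellPoisedInteriorForms
import HarnessLib.Audit
import HarnessLib

/-!
# The `Φ`-rate (8.10) in the INTERIOR of Zudilin's odd-zeta boxes, discharged in the kernel by
# OFFSET-FREE WITNESS CERTIFICATES — cell `pub-zeta5`, class `odd` (gen 65), SCOREBOARD §E "no-go theorem"

HONEST FRAMING: systematic search; no irrationality claim unless certified.  This file removes ONE of the two
printed hypotheses of the interior no-go `IntDir.interior_noGo` (tree, p319103): hypothesis `(ii)`, the `Φ`-rate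
`∀ φ' > φ, log Φ(h_n) ≤ φ'n` eventually ([Zudilin2004, (8.10)]), becomes a KERNEL THEOREM at every direction that
carries a checked certificate (`IntDir.log_intPhi_eventually_le`, `IntDir.interior_noGo_cert`).  What remains
conditional is hypothesis `(i)` alone ([Zudilin2004, Lemma 20]: the decay rate `C₀` of `F(h_n)` in the interior).
Nothing here says anything about `ζ(5)`: it is a NEGATIVE-shaped reduction.

## The mechanism (ours; elementary)
Along the ray `h₀ = η₀n + 2`, `h_j = η_j n + 1` of an integral direction `E : IntDir M` (`q = M + 5`), take in (8.9)
the index `k = c·n + m·p + 1` (`c, m ∈ ℤ`).  Every bracket of `ν_{k,p}` is then `[(γn + m'p)/p] = [γ n/p] + m'`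
with an INTEGER slope `γ` and the shifts `m'` cancel summand by summand (`pairTerm_witness`, `brickTerm_witness`):
`ν_{k,p} = F_c(n/p)` EXACTLY, `F_c(x) = Σ_{heads e} ([cx] + [(η₀−c)x] − [(c−e)x] − [(η₀−e−c)x] − 2[ex])
+ Σ_{tails b} ([(η₀−2b)x] − [(c−b)x] − [(η₀−b−c)x])` (`IntDir.wnu`; no `±1/p` offsets, hence no exceptional
primes).  The index is in the range `h₄ ≤ k ≤ h₀ − h₄` of (8.9) for `c ∈ {η_j, η₀ − η_j}` (`m = 0`) always, and for
EVERY integer `c` as soon as `(η₀ − 2η₄)n ≥ p` (`adm_sound`).  Hence `ν_p = min_k ν_{k,p} ≤ F_c(n/p)`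
(`nuPq_le_wnu`), and on a piece `x = n/p ∈ [a, b)` each bracket is bounded by its value at an endpoint
(`[γx] ≤ ⌈γb⌉ − 1` or `[γa]`; `[γx] ≥ [γa]` or `[γb]`: `fl_le_sF`, `iF_le_fl`), so `ν_p ≤ U_c(a, b)` — an integer the
kernel evaluates (`PhiPiece.U`, `PhiPiece.check`).  With `ν_p ≤ q + 3 = M + 8` for `p ≤ n/N₀` (`pairTerm_le_two`,
the tree's `brickTerm_le_one`) and a chain of pieces covering `[1/μ, N₀)` (`μ = M_{q−3}/n`, `PhiCert.cover`),
`Φ(h_n) ≤ (∏_{p ≤ n/N₀} p)^{M+8} · ∏_pieces (∏_{n/b < p ≤ n/a} p)^{g}` (`intPhi_le_cert`), and the prime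
number theorem window by window (the tree's `Hata1992.tendsto_log_windowProd_div`, from
`chebyshevTheta_isEquivalent`) gives `limsup (1/n) log Φ(h_n) ≤ φ̄ := (M+8)/N₀ + Σ g·(1/a − 1/b) ≤ (M+8)/N₀ + Sub/D`
(`IntDir.phiBar`, the `D`-scaled integer bookkeeping `ub` checked piece by piece).  `interior_noGo_cert`: a checked certificate +
`C₀ + φ̄ < δ` + Lemma 20's decay floor ⟹ `Λ_n ↛ 0`.  THIS FILE (part 1) = the local facts §§1–3 (witness identities,
piece checker and its soundness); part 2 `WellPoisedInteriorOddPhiRateCert` = certificates, `intPhi_le_cert`, the limit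
and `interior_noGo_cert`; the data files `WellPoisedInteriorOddPhiRateArgmax9` / `…Argmax11` = the two arg-max directions.
## Relation to the tree
The face files bound `Φ` by primorials of the ALIVE bricks (`PhiQ_face_le`, `log_facePhi_eventually_le`): at
`head = 0` that is the certificate with one piece.  `Literature/…/ZudilinPhi*.lean` certify LOWER bounds
`φ₀(x, y) ≥ c` for Theorem 3's direction (the positive use of `Φ`); here the inequality goes the other way (a
no-go needs `Φ` SMALL) and a single witness `y = cx` per piece suffices — no strip arrangement.  Certificates for
the two arg-max directions of the lane record are checked in `WellPoisedInteriorOddPhiRateArgmax9/11` (`decide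
+kernel`).  Standard axioms only.
## What is NOT proved here
Lemma 20 (hypothesis `(i)`); anything for directions without a certificate; any equality `φ̄ = φ` (the certificate
bound `φ̄` is an upper bound of Zudilin's `φ`, typically `φ̄ − φ ≈ (M+8)/N₀ −` the `x ≥ N₀` part).
-/

noncomputable section

open Real Finset Filter Topology

namespace Summit.KontsevichZagierPeriods.Zeta5Search

namespace WellPoisedFace

/-! ### 1. `ν_{k,p} ≤ q + 3`: each pair summand of (8.9) is `≤ 2` -/

-- LANE EDIT (P2 g8, dedup.landed): `pairTerm_le_two` (each pair summand `≤ 2`, two carries) is ALREADY in the tree as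
-- `WellPoisedInterior.pairTerm_le_two` (fam-vwp, `WellPoisedInteriorForms`, identical statement) — imported and reused below.

/-- `ν_{k,p} ≤ B + 6 = q + 3` for every `k` and every `p > 0` (`B = q − 3` bricks `≤ 1` each, three pairs `≤ 2` each). -/
theorem nuKPq_le (h0 h1 h2 h3 : ℤ) {B : ℕ} (h : Fin B → ℤ) (k : ℤ) {p : ℤ} (hp : 0 < p) :
    nuKPq h0 h1 h2 h3 h k p ≤ B + 6 := by
  unfold nuKPq
  have := WellPoisedInterior.pairTerm_le_two h0 h1 k hp
  have := WellPoisedInterior.pairTerm_le_two h0 h2 k hp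
  have := WellPoisedInterior.pairTerm_le_two h0 h3 k hp
  have hs : ∑ j, brickTerm h0 (h j) k p ≤ ∑ _j : Fin B, (1 : ℤ) :=
    Finset.sum_le_sum fun j _ => brickTerm_le_one h0 (h j) k hp
  rw [Finset.sum_const, Finset.card_univ, Fintype.card_fin, nsmul_eq_mul, mul_one] at hs
  linarith

/-- `ν_p ≤ ν_{k,p}` for every `k` in the range `kLo ≤ k ≤ h₀ − kLo` of (8.9). -/
theorem nuPq_le_nuKPq (h0 h1 h2 h3 : ℤ) {B : ℕ} (h : Fin B → ℤ) (kLo k p : ℤ) (hlo : kLo ≤ k)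
    (hhi : k ≤ h0 - kLo) : nuPq h0 h1 h2 h3 h kLo p ≤ nuKPq h0 h1 h2 h3 h k p := by
  have hr : kLo ≤ h0 - kLo := hlo.trans hhi
  rw [nuPq, dif_pos hr]
  exact Finset.inf'_le _ (Finset.mem_Icc.2 ⟨hlo, hhi⟩)

/-- `ν_p ≤ B + 6 = q + 3` for every `p > 0`. -/
theorem nuPq_le (h0 h1 h2 h3 : ℤ) {B : ℕ} (h : Fin B → ℤ) (kLo : ℤ) {p : ℤ} (hp : 0 < p) :
    nuPq h0 h1 h2 h3 h kLo p ≤ B + 6 := by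
  by_cases hr : kLo ≤ h0 - kLo
  · exact (nuPq_le_nuKPq h0 h1 h2 h3 h kLo kLo p le_rfl hr).trans (nuKPq_le h0 h1 h2 h3 h kLo hp)
  · rw [nuPq, dif_neg hr]; positivity

/-! ### 2. Offset-free witnesses: `ν_{cn+mp+1, p} = F_c(n/p)` exactly -/

/-- `[γ x]` for an integer slope `γ` and a rational point `x`. -/
def fl (γ : ℤ) (x : ℚ) : ℤ := ⌊(γ : ℚ) * x⌋

/-- `[γ · n/p] = (γ n) / p` (Euclidean division). -/
theorem fl_div (γ : ℤ) (n p : ℕ) : fl γ ((n : ℚ) / p) = γ * n / (p : ℤ) := by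
  unfold fl
  rw [← Rat.floor_intCast_div_natCast]
  congr 1
  push_cast
  ring

/-- `(a + m p)/p = a/p + m`. -/
theorem ediv_shift (a m : ℤ) {p : ℕ} (hp : 0 < p) : (a + m * p) / (p : ℤ) = a / p + m :=
  Int.add_mul_ediv_right a m (by exact_mod_cast hp.ne')

/-- THE PAIR SUMMAND AT A WITNESS: with `h₀ = η₀n + 2`, `h_j = e n + 1`, `k = cn + mp + 1`, the pair summand of
(8.9) is `[cx] + [(η₀−c)x] − [(c−e)x] − [(η₀−e−c)x] − 2[ex]`, `x = n/p` (the shifts `±m` cancel). -/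
theorem pairTerm_witness (η₀ e n : ℕ) (c m : ℤ) {p : ℕ} (hp : 0 < p) :
    pairTerm ((η₀ * n + 2 : ℕ) : ℤ) ((e * n + 1 : ℕ) : ℤ) (c * n + m * p + 1) p =
      fl c ((n : ℚ) / p) + fl (η₀ - c) ((n : ℚ) / p) - fl (c - e) ((n : ℚ) / p)
        - fl (η₀ - e - c) ((n : ℚ) / p) - 2 * fl e ((n : ℚ) / p) := by
  have t1 : (c * (n : ℤ) + m * (p : ℤ) + 1 - 1) / (p : ℤ) = fl c ((n : ℚ) / p) + m := by
    rw [show c * (n : ℤ) + m * (p : ℤ) + 1 - 1 = c * n + m * p by ring, ediv_shift _ _ hp, fl_div]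
  have t2 : (((η₀ * n + 2 : ℕ) : ℤ) - (c * n + m * p + 1) - 1) / (p : ℤ) = fl (η₀ - c) ((n : ℚ) / p) - m := by
    rw [show ((η₀ * n + 2 : ℕ) : ℤ) - (c * n + m * p + 1) - 1 = ((η₀ : ℤ) - c) * n + (-m) * p by push_cast; ring,
      ediv_shift _ _ hp, fl_div]
    ring
  have t3 : (c * (n : ℤ) + m * (p : ℤ) + 1 - ((e * n + 1 : ℕ) : ℤ)) / (p : ℤ) = fl (c - e) ((n : ℚ) / p) + m := by
    rw [show c * (n : ℤ) + m * (p : ℤ) + 1 - ((e * n + 1 : ℕ) : ℤ) = (c - (e : ℤ)) * n + m * p by push_cast; ring,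
      ediv_shift _ _ hp, fl_div]
  have t4 : (((η₀ * n + 2 : ℕ) : ℤ) - ((e * n + 1 : ℕ) : ℤ) - (c * n + m * p + 1)) / (p : ℤ)
      = fl (η₀ - e - c) ((n : ℚ) / p) - m := by
    rw [show ((η₀ * n + 2 : ℕ) : ℤ) - ((e * n + 1 : ℕ) : ℤ) - (c * n + m * p + 1)
        = ((η₀ : ℤ) - e - c) * n + (-m) * p by push_cast; ring, ediv_shift _ _ hp, fl_div]
    ring
  have t5 : (((e * n + 1 : ℕ) : ℤ) - 1) / (p : ℤ) = fl e ((n : ℚ) / p) := by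
    rw [show ((e * n + 1 : ℕ) : ℤ) - 1 = (e : ℤ) * n by push_cast; ring, fl_div]
  unfold pairTerm
  rw [t1, t2, t3, t4, t5]
  ring

/-- THE BRICK SUMMAND AT A WITNESS: with `h_j = b n + 1`, `k = cn + mp + 1`: `[(η₀−2b)x] − [(c−b)x] − [(η₀−b−c)x]`. -/
theorem brickTerm_witness (η₀ b n : ℕ) (c m : ℤ) {p : ℕ} (hp : 0 < p) :
    brickTerm ((η₀ * n + 2 : ℕ) : ℤ) ((b * n + 1 : ℕ) : ℤ) (c * n + m * p + 1) p =
      fl (η₀ - 2 * b) ((n : ℚ) / p) - fl (c - b) ((n : ℚ) / p) - fl (η₀ - b - c) ((n : ℚ) / p) := by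
  have s1 : (((η₀ * n + 2 : ℕ) : ℤ) - 2 * ((b * n + 1 : ℕ) : ℤ)) / (p : ℤ) = fl (η₀ - 2 * b) ((n : ℚ) / p) := by
    rw [show ((η₀ * n + 2 : ℕ) : ℤ) - 2 * ((b * n + 1 : ℕ) : ℤ) = ((η₀ : ℤ) - 2 * b) * n by push_cast; ring,
      fl_div]
  have s2 : (c * (n : ℤ) + m * (p : ℤ) + 1 - ((b * n + 1 : ℕ) : ℤ)) / (p : ℤ) = fl (c - b) ((n : ℚ) / p) + m := by
    rw [show c * (n : ℤ) + m * (p : ℤ) + 1 - ((b * n + 1 : ℕ) : ℤ) = (c - (b : ℤ)) * n + m * p by push_cast; ring,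
      ediv_shift _ _ hp, fl_div]
  have s3 : (((η₀ * n + 2 : ℕ) : ℤ) - ((b * n + 1 : ℕ) : ℤ) - (c * n + m * p + 1)) / (p : ℤ)
      = fl (η₀ - b - c) ((n : ℚ) / p) - m := by
    rw [show ((η₀ * n + 2 : ℕ) : ℤ) - ((b * n + 1 : ℕ) : ℤ) - (c * n + m * p + 1)
        = ((η₀ : ℤ) - b - c) * n + (-m) * p by push_cast; ring, ediv_shift _ _ hp, fl_div]
    ring
  unfold brickTerm
  rw [s1, s2, s3]
  ring

namespace IntDir

variable {M : ℕ} (E : IntDir M)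

/-- `F_c(x)`: (8.9)'s `ν_{k,p}` at the witness `k = cn + mp + 1`, as a function of `x = n/p` alone. -/
def wnu (c : ℤ) (x : ℚ) : ℤ :=
  ∑ i : Fin 3, (fl c x + fl (E.η₀ - c) x - fl (c - E.head i) x - fl (E.η₀ - E.head i - c) x - 2 * fl (E.head i) x)
    + ∑ j : Fin (M + 2), (fl (E.η₀ - 2 * E.tail j) x - fl (c - E.tail j) x - fl (E.η₀ - E.tail j - c) x)

/-- **`ν_{cn+mp+1, p} = F_c(n/p)`** at the ray, for every `c, m ∈ ℤ` and `p > 0`. -/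
theorem nuKPq_witness (n : ℕ) (c m : ℤ) {p : ℕ} (hp : 0 < p) :
    nuKPq (E.h0 n) (E.hP n 0) (E.hP n 1) (E.hP n 2) (E.hT n) (c * n + m * p + 1) p = E.wnu c ((n : ℚ) / p) := by
  unfold nuKPq wnu IntFaceDir.h0 hP IntFaceDir.hT
  rw [pairTerm_witness _ _ _ _ _ hp, pairTerm_witness _ _ _ _ _ hp, pairTerm_witness _ _ _ _ _ hp,
    Fin.sum_univ_three]
  simp only [brickTerm_witness _ _ _ _ _ hp]

/-- **`ν_p ≤ F_c(n/p)`** whenever the witness is in range: `η₄ n ≤ cn + mp ≤ (η₀ − η₄) n`. -/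
theorem nuPq_le_wnu (n : ℕ) (c m : ℤ) {p : ℕ} (hp : 0 < p)
    (hlo : (E.a : ℤ) * n ≤ c * n + m * p) (hhi : c * n + m * p ≤ ((E.η₀ : ℤ) - E.a) * n) :
    nuPq (E.h0 n) (E.hP n 0) (E.hP n 1) (E.hP n 2) (E.hT n) (E.hT n 0) p ≤ E.wnu c ((n : ℚ) / p) := by
  rw [← E.nuKPq_witness n c m hp]
  apply nuPq_le_nuKPq
  · unfold IntFaceDir.hT; unfold IntFaceDir.a at hlo; push_cast; linarith
  · unfold IntFaceDir.hT IntFaceDir.h0; unfold IntFaceDir.a at hhi; push_cast; linarith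

/-- `ν_p ≤ M + 8 = q + 3` at the ray, every `p > 0`. -/
theorem nuPq_le_M (n : ℕ) {p : ℕ} (hp : 0 < p) :
    nuPq (E.h0 n) (E.hP n 0) (E.hP n 1) (E.hP n 2) (E.hT n) (E.hT n 0) p ≤ ((M + 8 : ℕ) : ℤ) := by
  have h := nuPq_le (E.h0 n) (E.hP n 0) (E.hP n 1) (E.hP n 2) (E.hT n) (E.hT n 0) (p := (p : ℤ))
    (by exact_mod_cast hp)
  push_cast at h ⊢
  linarith

end IntDir

/-! ### 3. Pieces `x ∈ [a, b)`: the endpoint bounds of the brackets and the integer checker -/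

/-- A PIECE of a `Φ`-rate certificate: `x = n/p ∈ [an/ad, bn/bd)`, witness slope `c`, claimed bound `g ≥ F_c` on the
piece, and the `D`-scaled weight `ub ≥ D·g·(1/a − 1/b)`. -/
structure PhiPiece where
  /-- left endpoint numerator -/ an : ℕ
  /-- left endpoint denominator -/ ad : ℕ
  /-- right endpoint numerator -/ bn : ℕ
  /-- right endpoint denominator -/ bd : ℕ
  /-- witness slope -/ c : ℤ
  /-- bound for `ν_p` on the piece -/ g : ℕ
  /-- `D`-scaled weight -/ ub : ℕ

namespace PhiPiece

variable (P : PhiPiece)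

/-- `a = an/ad`. -/ def a : ℚ := (P.an : ℚ) / P.ad
/-- `b = bn/bd`. -/ def b : ℚ := (P.bn : ℚ) / P.bd

/-- Upper bound of `[γx]` on `[a, b)`: `⌈γb⌉ − 1 = (γ·bn − 1)/bd` for `γ > 0`, `[γa]` for `γ ≤ 0`. -/
def sF (γ : ℤ) : ℤ := if 0 < γ then (γ * P.bn - 1) / (P.bd : ℤ) else γ * P.an / (P.ad : ℤ)

/-- Lower bound of `[γx]` on `[a, b)`: `[γa]` for `γ ≥ 0`, `[γb]` for `γ < 0`. -/
def iF (γ : ℤ) : ℤ := if 0 ≤ γ then γ * P.an / (P.ad : ℤ) else γ * P.bn / (P.bd : ℤ)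

/-- `U_c(a, b)`: the endpoint upper bound of `F_c` on the piece, from the direction data `η₀`, heads, tails. -/
def U (η₀ : ℕ) (heads tails : List ℕ) : ℤ :=
  (heads.map fun e : ℕ => P.sF P.c + P.sF (η₀ - P.c) - P.iF (P.c - e) - P.iF (η₀ - e - P.c) - 2 * P.iF e).sum
    + (tails.map fun b : ℕ => P.sF (η₀ - 2 * b) - P.iF (P.c - b) - P.iF (η₀ - b - P.c)).sum

/-- Admissibility of the witness on the whole piece: tail type `c ∈ {η_j, η₀ − η_j}` (in range with `m = 0`), or
`(η₀ − 2η₄)·a ≥ 1` (then every integer slope is in range for some `m`). -/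
def adm (η₀ a4 : ℕ) (tails : List ℕ) : Bool :=
  tails.any (fun b : ℕ => P.c == (b : ℤ) || P.c == (η₀ : ℤ) - b) || decide (P.ad ≤ (η₀ - 2 * a4) * P.an)

/-- The piece checker: `0 < a < b` well formed, witness admissible, `U ≤ g`, `D·g·(1/a − 1/b) ≤ ub`. -/
def check (η₀ a4 : ℕ) (heads tails : List ℕ) (D : ℕ) : Bool :=
  decide (0 < P.an) && decide (0 < P.ad) && decide (0 < P.bd) && decide (P.an * P.bd < P.bn * P.ad)
    && P.adm η₀ a4 tails && decide (P.U η₀ heads tails ≤ P.g)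
    && decide (D * P.g * (P.ad * P.bn) ≤ P.ub * (P.an * P.bn) + D * P.g * (P.bd * P.an))

/-- What the checker says. -/
theorem check_spec {η₀ a4 : ℕ} {heads tails : List ℕ} {D : ℕ} (h : P.check η₀ a4 heads tails D = true) :
    0 < P.an ∧ 0 < P.ad ∧ 0 < P.bd ∧ P.an * P.bd < P.bn * P.ad ∧ P.adm η₀ a4 tails = true
      ∧ P.U η₀ heads tails ≤ P.g ∧ D * P.g * (P.ad * P.bn) ≤ P.ub * (P.an * P.bn) + D * P.g * (P.bd * P.an) := by
  simpa [check, Bool.and_eq_true, decide_eq_true_eq, and_assoc] using h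

/-- `0 < a`, `a < b` (hence `0 < b`) for a checked piece, over `ℚ`. -/
theorem a_pos_lt_b {η₀ a4 : ℕ} {heads tails : List ℕ} {D : ℕ} (h : P.check η₀ a4 heads tails D = true) :
    0 < P.a ∧ P.a < P.b := by
  obtain ⟨han, had, hbd, hab, -⟩ := P.check_spec h
  have han' : (0 : ℚ) < P.an := by exact_mod_cast han
  have had' : (0 : ℚ) < P.ad := by exact_mod_cast had
  have hbd' : (0 : ℚ) < P.bd := by exact_mod_cast hbd
  have hab' : (P.an : ℚ) * P.bd < P.bn * P.ad := by exact_mod_cast hab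
  refine ⟨div_pos han' had', ?_⟩
  unfold a b
  rw [div_lt_div_iff₀ had' hbd']
  exact hab'

/-- `[γx] ≤ sF γ` for `x ∈ [a, b)`. -/
theorem fl_le_sF (hbd : 0 < P.bd) {x : ℚ} (hax : P.a ≤ x) (hxb : x < P.b) (γ : ℤ) :
    fl γ x ≤ P.sF γ := by
  unfold sF fl
  split_ifs with hγ
  · rw [Int.le_ediv_iff_mul_le (by exact_mod_cast hbd)]
    have hbd' : (0 : ℚ) < P.bd := by exact_mod_cast hbd
    have h1 : ((⌊(γ : ℚ) * x⌋ : ℤ) : ℚ) < γ * P.bn / P.bd := by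
      calc ((⌊(γ : ℚ) * x⌋ : ℤ) : ℚ) ≤ γ * x := Int.floor_le _
        _ < γ * P.b := mul_lt_mul_of_pos_left hxb (by exact_mod_cast hγ)
        _ = γ * P.bn / P.bd := by unfold b; ring
    rw [lt_div_iff₀ hbd'] at h1
    have h2 : ⌊(γ : ℚ) * x⌋ * (P.bd : ℤ) < γ * P.bn := by exact_mod_cast h1
    linarith
  · push Not at hγ
    rw [← Rat.floor_intCast_div_natCast]
    apply Int.floor_le_floor
    have h1 : (γ : ℚ) * x ≤ γ * P.a := mul_le_mul_of_nonpos_left hax (by exact_mod_cast hγ)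
    unfold a at h1
    push_cast
    calc (γ : ℚ) * x ≤ γ * ((P.an : ℚ) / P.ad) := h1
      _ = γ * P.an / P.ad := by ring

/-- `iF γ ≤ [γx]` for `x ∈ [a, b)`. -/
theorem iF_le_fl {x : ℚ} (hax : P.a ≤ x) (hxb : x < P.b) (γ : ℤ) :
    P.iF γ ≤ fl γ x := by
  unfold iF fl
  split_ifs with hγ
  · rw [← Rat.floor_intCast_div_natCast]
    apply Int.floor_le_floor
    have h1 : (γ : ℚ) * P.a ≤ γ * x := mul_le_mul_of_nonneg_left hax (by exact_mod_cast hγ)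
    unfold a at h1
    push_cast
    calc ((γ : ℚ) * P.an) / P.ad = γ * ((P.an : ℚ) / P.ad) := by ring
      _ ≤ γ * x := h1
  · push Not at hγ
    rw [← Rat.floor_intCast_div_natCast]
    apply Int.floor_le_floor
    have h1 : (γ : ℚ) * P.b ≤ γ * x := mul_le_mul_of_nonpos_left hxb.le (by exact_mod_cast hγ.le)
    unfold b at h1
    push_cast
    calc ((γ : ℚ) * P.bn) / P.bd = γ * ((P.bn : ℚ) / P.bd) := by ring
      _ ≤ γ * x := h1

end PhiPiece

namespace IntDir

variable {M : ℕ} (E : IntDir M)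

/-- `F_c(x) ≤ U_c(a, b)` on the piece. -/
theorem wnu_le_U (P : PhiPiece) (hbd : 0 < P.bd) {x : ℚ} (hax : P.a ≤ x) (hxb : x < P.b) :
    E.wnu P.c x ≤ P.U E.η₀ (List.ofFn E.head) (List.ofFn E.tail) := by
  unfold wnu PhiPiece.U
  rw [List.map_ofFn, List.map_ofFn, List.sum_ofFn, List.sum_ofFn]
  have hs := fun γ => P.fl_le_sF hbd hax hxb γ
  have hi := fun γ => P.iF_le_fl hax hxb γ
  apply add_le_add
  · refine Finset.sum_le_sum fun i _ => ?_
    simp only [Function.comp_apply]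
    have := hs P.c; have := hs (E.η₀ - P.c); have := hi (P.c - E.head i)
    have := hi (E.η₀ - E.head i - P.c); have := hi (E.head i)
    linarith
  · refine Finset.sum_le_sum fun j _ => ?_
    simp only [Function.comp_apply]
    have := hs (E.η₀ - 2 * E.tail j); have := hi (P.c - E.tail j); have := hi (E.η₀ - E.tail j - P.c)
    linarith

/-- An admissible witness is in the range of (8.9) at every `(n, p)` of the piece: there is `m` with
`η₄ n ≤ cn + mp ≤ (η₀ − η₄) n`. -/
theorem adm_sound (P : PhiPiece) (hadm : P.adm E.η₀ E.a (List.ofFn E.tail) = true) {n p : ℕ} (hp : 0 < p)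
    (hax : P.a ≤ (n : ℚ) / p) (had : 0 < P.ad) :
    ∃ m : ℤ, (E.a : ℤ) * n ≤ P.c * n + m * p ∧ P.c * n + m * p ≤ ((E.η₀ : ℤ) - E.a) * n := by
  unfold PhiPiece.adm at hadm
  rw [Bool.or_eq_true, List.any_eq_true, decide_eq_true_eq] at hadm
  have hn : (0 : ℤ) ≤ n := by positivity
  rcases hadm with ⟨b, hb, hcb⟩ | hgen
  · rw [List.mem_ofFn] at hb
    obtain ⟨j, rfl⟩ := hb
    have h1 : (E.a : ℤ) ≤ E.tail j := by unfold IntFaceDir.a; exact_mod_cast E.hlo j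
    have h2 : 2 * (E.tail j : ℤ) ≤ E.η₀ := by exact_mod_cast E.two_tail_le j
    rw [Bool.or_eq_true, beq_iff_eq, beq_iff_eq] at hcb
    refine ⟨0, ?_, ?_⟩ <;> rcases hcb with h | h <;> rw [h] <;> nlinarith
  · -- every slope is in range once `(η₀ − 2η₄) n ≥ p`
    have h2a : 2 * E.a ≤ E.η₀ := E.two_tail_le 0
    have hx : (p : ℚ) ≤ ((E.η₀ - 2 * E.a : ℕ) : ℚ) * n := by
      have hp' : (0 : ℚ) < p := by exact_mod_cast hp
      have had' : (0 : ℚ) < P.ad := by exact_mod_cast had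
      have hg : (P.ad : ℚ) ≤ ((E.η₀ - 2 * E.a : ℕ) : ℚ) * P.an := by exact_mod_cast hgen
      have hax' : (P.an : ℚ) * p ≤ P.ad * n := by
        unfold PhiPiece.a at hax
        rw [div_le_div_iff₀ had' hp'] at hax
        linarith
      have hk : (0 : ℚ) ≤ ((E.η₀ - 2 * E.a : ℕ) : ℚ) := Nat.cast_nonneg _
      nlinarith
    have hx' : (p : ℤ) ≤ ((E.η₀ : ℤ) - 2 * E.a) * n := by
      have h := hx
      rw [Nat.cast_sub h2a] at h
      push_cast at h
      exact_mod_cast h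
    set R : ℤ := ((E.η₀ : ℤ) - E.a - P.c) * n with hR
    refine ⟨R / p, ?_, ?_⟩
    · have h1 : R < (R / p + 1) * p := Int.lt_ediv_add_one_mul_self R (by exact_mod_cast hp)
      nlinarith
    · have h1 : R / p * p ≤ R := Int.ediv_mul_le R (by exact_mod_cast hp.ne')
      nlinarith

end IntDir

end WellPoisedFace

end Summit.KontsevichZagierPeriods.Zeta5Search

end
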